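import Literature.MathematicalPhysics.QuantumFieldTheory.SUNBakryEmeryVarianceDecay
import Mathlib.MeasureTheory.Integral.Bochner.Set
import HarnessLib

/-!
# The Bakry–Émery logarithmic Sobolev inequality for the Haar measure of `SU(N)`

Final file of the dynamic Bakry–Émery argument (Bakry–Émery 1985; Bakry–Gentil–Ledoux 2014, Prop. 5.7.1 «logarithmic
Sobolev inequality under `CD(ρ,∞)`», proof p. 268–269) for the Haar probability measure `σ` of `SU(N)` with the
Laplace–Beltrami operator `Δ = ∑_α D_α²` of the bi-invariant Hilbert–Schmidt metric (`Ric = N/2`, Shen–Zhu–Zhu (4.8)), in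
the ambient-coordinate calculus of `SUNBakryEmeryPoincare.lean`.  Assembling `exists_polyFlow` / `polyFlow_ge_of_ge`
(heat flow on polynomials and its positivity), `hasDerivAt_entropy_flow` (de Bruijn), `hasDerivAt_fisher_flow_le`
(`I' ≤ −N I`), `variance_flow_le` and `entropy_le_variance_div` (`Ent_σ(p_T) ≤ e^{−NT}Var_σ(p)/m → 0`):

* ★★ `logSobolev_poly_pos` — **`Ent_σ(p) ≤ (1/N) ∫ Γ(p,p)/p dσ`** for every polynomial `p > 0` on `SU(N)` (BGL (5.7.1) with
  `ρ = N/2`): `t ↦ e^{Nt} I(p_t)` is non-increasing and `t ↦ ∫ p_t log p_t − e^{−Nt}I(p)/N` non-decreasing on `[0,∞)`;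
* ★★ `logSobolev_poly` — **`Ent_σ(u²) ≤ (4/N) ∫ Γ(u,u) dσ`** for every polynomial `u ∈ 𝒫_n` (apply the above to
  `u² + ε ↓ u²`): the log-Sobolev inequality `LS(2/N)` of BGL Prop. 5.7.1 for `(SU(N), σ, Γ)`, i.e. Shen–Zhu–Zhu's
  (4.12) `μ(F² log F²) ≤ (2/K_S) μ(|∇F|²)` at `β = 0` for one link (`K_S = N/2`).

The class of test functions is the `Δ`-invariant algebra of polynomial (`SU(N)`-finite) functions, dense in `C(SU(N))`
(the «`𝒜₀`» of BGL); the extension to all smooth ambient functions is routine approximation and is NOT done here.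
Theorems only; no definition.  Nothing here concerns the Yang–Mills mass gap.

## References

* D. Bakry, M. Émery, *Diffusions hypercontractives*, Sém. Probab. XIX, LNM 1123 (1985) 177–206.
* D. Bakry, I. Gentil, M. Ledoux, *Analysis and Geometry of Markov Diffusion Operators*, Grundlehren 348 (2014),
  Prop. 5.7.1, (5.7.1)–(5.7.4), Prop. 5.2.2, Thm. 4.2.5.
* H. Shen, R. Zhu, X. Zhu, CMP 400 (2023) 805–851 = arXiv:2204.12737, Thm. 4.2, (4.7)–(4.8), Cor. 4.4 (4.12).
-/

noncomputable section

open scoped Matrix ComplexConjugate BigOperators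

namespace Literature.MathematicalPhysics.QuantumFieldTheory

namespace SUNBakryEmery

open scoped Matrix.Norms.Frobenius ContDiff Topology
open Matrix Complex Finset MeasureTheory Filter Set Metric

variable {N : ℕ}

/-! ### ★★ The log-Sobolev inequality for positive polynomials -/

/-- ★★ **Bakry–Émery log-Sobolev inequality for the Haar measure of `SU(N)`, positive polynomials, Fisher-information form**
(BGL (5.7.1): `Ent_μ(f) ≤ (1/2ρ) ∫ Γ(f)/f dμ` under `CD(ρ,∞)`; here `ρ = N/2`, `Ric = N/2` on `SU(N)`, Shen–Zhu–Zhu (4.8)):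
for every polynomial function `p ∈ 𝒫_n` with `p ≥ δ > 0` on `SU(N)`,
`∫ p log p dσ − (∫ p dσ) log(∫ p dσ) ≤ (1/N) ∫ Γ(p,p)/p dσ`.
Proof (BGL p. 268–269 on the finite-dimensional model `e^{tΔ}|_{𝒫_n}`): along the heat flow `p_t` (positive by the minimum
principle), `H(t) = ∫ p_t log p_t` has `H' = −I` (de Bruijn) and `I' ≤ −N I` (`Γ₂ ≥ (N/2)Γ`), so `e^{Nt}I(t)` decreases,
`H(0) − I(0)/N ≤ H(T)`, and `H(T) − m log m = Ent(p_T) ≤ Var(p_T)/m ≤ e^{−NT}Var(p)/m → 0`.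
[cite: BakryGentilLedoux2014, Prop. 5.7.1 (5.7.1)] -/
theorem logSobolev_poly_pos (hN : N ≠ 0) {n : ℕ} {p : Matrix (Fin N) (Fin N) ℂ → ℝ} (hp : p ∈ polySpace N n)
    {δ : ℝ} (hδ : 0 < δ) (hpos : ∀ g : SUN N, δ ≤ p g) :
    ∫ g : SUN N, p g * Real.log (p g) ∂(haarSU N) -
        (∫ g : SUN N, p g ∂(haarSU N)) * Real.log (∫ g : SUN N, p g ∂(haarSU N)) ≤
      1 / (N : ℝ) * ∫ g : SUN N, Gam p p g / p g ∂(haarSU N) := by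
  set σ := haarSU N with hσ
  obtain ⟨d, b, c, c', hbmem, hp0, hc, hc', hheat⟩ := exists_polyFlow hp
  subst hp0
  have hb : ∀ i, ContDiff ℝ ∞ (b i) := fun i => contDiff_of_mem_polySpace (hbmem i)
  have hNpos : (0 : ℝ) < N := Nat.cast_pos.2 (Nat.pos_of_ne_zero hN)
  -- notation
  set P : ℝ → SUN N → ℝ := fun t g => ∑ i, c t i * b i (g : Matrix (Fin N) (Fin N) ℂ) with hP
  have hheat' : ∀ t (g : SUN N), Lap (fun Q => ∑ i, c t i * b i Q) (g : Matrix (Fin N) (Fin N) ℂ) =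
      ∑ i, c' t i * b i (g : Matrix (Fin N) (Fin N) ℂ) := fun t g => congrFun (hheat t) _
  have hcc : ∀ i, Continuous fun t => c t i := continuous_coeff_of_hasDerivAt hc
  have hbc : ∀ i, Continuous fun g : SUN N => b i (g : Matrix (Fin N) (Fin N) ℂ) :=
    fun i => continuous_restrict (hb i)
  have hPc : Continuous (Function.uncurry P) := continuous_sum_mul_uncurry hcc hbc
  -- (1) positivity for `t ≥ 0` (minimum principle)
  have hpos0 : ∀ g : SUN N, δ ≤ P 0 g := fun g => by simpa using hpos g
  have hposT : ∀ t, 0 ≤ t → ∀ g : SUN N, δ ≤ P t g := fun t ht g => polyFlow_ge_of_ge hN hb hc hheat' hpos0 ht g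
  -- (2) positivity `≥ δ/2` slightly before `t = 0` (tube lemma), hence on every slab around `t₀ ≥ 0`
  obtain ⟨τ, hτ, hτpos⟩ : ∃ τ > 0, ∀ t : ℝ, dist t 0 < τ → ∀ g : SUN N, δ / 2 < P t g := by
    have h : ∀ᶠ t in 𝓝 (0 : ℝ), ∀ g ∈ (univ : Set (SUN N)), δ / 2 < P t g := by
      refine isCompact_univ.eventually_forall_of_forall_eventually fun g _ => ?_
      have hct : Tendsto (Function.uncurry P) (𝓝 ((0 : ℝ), g)) (𝓝 (P 0 g)) := hPc.continuousAt
      have hlt : δ / 2 < P 0 g := by linarith [hposT 0 le_rfl g]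
      exact hct.eventually_const_lt hlt
    obtain ⟨τ, hτ, h⟩ := Metric.eventually_nhds_iff.1 h
    exact ⟨τ, hτ, fun t ht g => h ht g (mem_univ _)⟩
  have hδ2 : 0 < δ / 2 := by linarith
  have hτ2 : 0 < τ / 2 := by linarith
  have hslab : ∀ t₀, 0 ≤ t₀ → ∀ t ∈ Icc (t₀ - τ / 2) (t₀ + τ / 2), ∀ g : SUN N,
      δ / 2 ≤ ∑ i, c t i * b i (g : Matrix (Fin N) (Fin N) ℂ) := by
    intro t₀ ht₀ t ht g
    by_cases h0 : 0 ≤ t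
    · have := hposT t h0 g; simp only [hP] at this; linarith
    · push Not at h0
      have hd : dist t 0 < τ := by
        rw [Real.dist_eq, sub_zero, abs_lt]; constructor <;> linarith [ht.1]
      exact (hτpos t hd g).le
  -- (3) the entropy functional `H` and the Fisher information `I` along the flow
  set H : ℝ → ℝ := fun t => ∫ g : SUN N, P t g * Real.log (P t g) ∂σ with hH
  set I : ℝ → ℝ := fun t => ∫ g : SUN N, Gam (fun Q => ∑ i, c t i * b i Q) (fun Q => ∑ i, c t i * b i Q) g /
    P t g ∂σ with hI
  have hHd : ∀ t, 0 ≤ t → HasDerivAt H (-I t) t := fun t ht =>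
    hasDerivAt_entropy_flow hN hb hc hc' hheat hδ2 hτ2 (hslab t ht)
  have hId : ∀ t, 0 ≤ t → ∃ D, HasDerivAt I D t ∧ D ≤ -(N : ℝ) * I t := fun t ht =>
    hasDerivAt_fisher_flow_le hN hb hc hc' hheat hδ2 hτ2 (hslab t ht)
  have hI0 : 0 ≤ I 0 :=
    integral_nonneg fun g => div_nonneg (Gam_self_nonneg _ _) (by linarith [hposT 0 le_rfl g])
  -- (4) `e^{Nt} I(t)` is non-increasing on `[0, ∞)`: `I(t) ≤ e^{−Nt} I(0)`
  have hI_le : ∀ t, 0 ≤ t → I t ≤ Real.exp (-(N : ℝ) * t) * I 0 := by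
    set J : ℝ → ℝ := fun s => Real.exp ((N : ℝ) * s) * I s with hJ
    have hJd : ∀ s, 0 ≤ s → ∃ D, HasDerivAt J D s ∧ D ≤ 0 := by
      intro s hs
      obtain ⟨D, hD, hDle⟩ := hId s hs
      have he : HasDerivAt (fun s => Real.exp ((N : ℝ) * s)) (Real.exp ((N : ℝ) * s) * N) s := by
        have := ((hasDerivAt_id s).const_mul (N : ℝ)).exp
        simpa using this
      refine ⟨_, he.mul hD, ?_⟩
      have h1 : Real.exp ((N : ℝ) * s) * D ≤ Real.exp ((N : ℝ) * s) * (-(N : ℝ) * I s) :=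
        mul_le_mul_of_nonneg_left hDle (Real.exp_pos _).le
      nlinarith [Real.exp_pos ((N : ℝ) * s)]
    have hanti : AntitoneOn J (Ici 0) := by
      refine antitoneOn_of_deriv_nonpos (convex_Ici 0) (fun s hs => ?_) (fun s hs => ?_) fun s hs => ?_
      · obtain ⟨D, hD, -⟩ := hJd s hs
        exact hD.continuousAt.continuousWithinAt
      · rw [interior_Ici] at hs
        obtain ⟨D, hD, -⟩ := hJd s (le_of_lt hs)
        exact hD.differentiableAt.differentiableWithinAt
      · rw [interior_Ici] at hs
        obtain ⟨D, hD, hle⟩ := hJd s (le_of_lt hs)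
        rw [hD.deriv]
        exact hle
    intro t ht
    have h := hanti (mem_Ici.2 le_rfl) (mem_Ici.2 ht) ht
    simp only [hJ, mul_zero, Real.exp_zero, one_mul] at h
    have hexp : Real.exp (-(N : ℝ) * t) * Real.exp ((N : ℝ) * t) = 1 := by rw [← Real.exp_add]; simp
    calc I t = Real.exp (-(N : ℝ) * t) * (Real.exp ((N : ℝ) * t) * I t) := by rw [← mul_assoc, hexp, one_mul]
      _ ≤ Real.exp (-(N : ℝ) * t) * I 0 := mul_le_mul_of_nonneg_left h (Real.exp_pos _).le
  -- (5) `H(t) − e^{−Nt} I(0)/N` is non-decreasing on `[0, ∞)`: `H(0) − I(0)/N ≤ H(T)`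
  have hH_le : ∀ T, 0 ≤ T → H 0 - I 0 / N ≤ H T := by
    set Φ : ℝ → ℝ := fun s => H s - Real.exp (-(N : ℝ) * s) * I 0 / N with hΦ
    have hΦd : ∀ s, 0 ≤ s → HasDerivAt Φ (-I s + Real.exp (-(N : ℝ) * s) * I 0) s := by
      intro s hs
      have h1 : HasDerivAt (fun s => Real.exp (-(N : ℝ) * s)) (Real.exp (-(N : ℝ) * s) * (-(N : ℝ))) s := by
        have := ((hasDerivAt_id s).const_mul (-(N : ℝ))).exp
        simpa using this
      have h2 : HasDerivAt (fun s => Real.exp (-(N : ℝ) * s) * I 0 / N) (-(Real.exp (-(N : ℝ) * s) * I 0)) s := by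
        have h := (h1.mul_const (I 0)).div_const (N : ℝ)
        refine h.congr_deriv ?_
        field_simp
      exact ((hHd s hs).sub h2).congr_deriv (by ring)
    have hmono : MonotoneOn Φ (Ici 0) := by
      refine monotoneOn_of_deriv_nonneg (convex_Ici 0) (fun s hs => ?_) (fun s hs => ?_) fun s hs => ?_
      · exact (hΦd s hs).continuousAt.continuousWithinAt
      · rw [interior_Ici] at hs
        exact (hΦd s (le_of_lt hs)).differentiableAt.differentiableWithinAt
      · rw [interior_Ici] at hs
        rw [(hΦd s (le_of_lt hs)).deriv]
        linarith [hI_le s (le_of_lt hs)]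
    intro T hT
    have h := hmono (mem_Ici.2 le_rfl) (mem_Ici.2 hT) hT
    simp only [hΦ, mul_zero, Real.exp_zero, one_mul] at h
    have : 0 ≤ Real.exp (-(N : ℝ) * T) * I 0 / N := div_nonneg (mul_nonneg (Real.exp_pos _).le hI0) hNpos.le
    linarith
  -- (6) `Ent(p_T) ≤ Var(p_T)/m ≤ e^{−NT} Var(p)/m`
  set m := ∫ g : SUN N, P 0 g ∂σ with hm
  have hm0 : ∀ t, ∫ g : SUN N, P t g ∂σ = m := fun t => polyFlow_integral_eq hN hb hc hheat t
  have hmpos : 0 < m := by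
    have h := integral_mono (integrable_const (μ := σ) δ)
      (integrable_of_continuous_SUN (hPc.comp (Continuous.prodMk_right 0)) _) hpos0
    simp only [integral_const, smul_eq_mul, probReal_univ, one_mul] at h
    exact lt_of_lt_of_le hδ h
  set V0 := ∫ g : SUN N, (P 0 g - m) ^ 2 ∂σ with hV0
  have hEntT : ∀ T, 0 ≤ T → H T - m * Real.log m ≤ Real.exp (-(N : ℝ) * T) * V0 / m := by
    intro T hT
    have hcT : Continuous (P T) := hPc.comp (Continuous.prodMk_right T)
    have hposT' : ∀ g, 0 < P T g := fun g => lt_of_lt_of_le hδ (hposT T hT g)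
    have h1 := entropy_le_variance_div hcT hposT' (by rw [hm0 T]; exact hmpos)
    rw [hm0 T] at h1
    have h2 := variance_flow_le hN hb hc hc' hheat hT
    have e0 : ∫ g' : SUN N, ∑ i, c 0 i * b i (g' : Matrix (Fin N) (Fin N) ℂ) ∂(haarSU N) = m := hm0 0
    rw [e0] at h2
    calc H T - m * Real.log m ≤ (∫ g, (P T g - m) ^ 2 ∂σ) / m := h1
      _ ≤ Real.exp (-(N : ℝ) * T) * V0 / m := div_le_div_of_nonneg_right h2 hmpos.le
  -- (7) let `T → ∞`
  have hlim : Tendsto (fun T : ℝ => I 0 / N + Real.exp (-(N : ℝ) * T) * V0 / m) atTop (𝓝 (I 0 / N + 0 * V0 / m)) := by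
    refine tendsto_const_nhds.add ((Tendsto.mul_const V0 ?_).div_const m)
    have h := Real.tendsto_exp_neg_atTop_nhds_zero.comp (tendsto_id.const_mul_atTop hNpos)
    refine h.congr fun T => ?_
    simp [neg_mul]
  rw [zero_mul, zero_div, add_zero] at hlim
  have hev : ∀ᶠ T in atTop, H 0 - m * Real.log m ≤ I 0 / N + Real.exp (-(N : ℝ) * T) * V0 / m := by
    filter_upwards [eventually_ge_atTop (0 : ℝ)] with T hT
    linarith [hH_le T hT, hEntT T hT]
  have hfin : H 0 - m * Real.log m ≤ I 0 / N := ge_of_tendsto hlim hev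
  have hfin' : H 0 - m * Real.log m ≤ 1 / (N : ℝ) * I 0 := by
    simpa only [one_div, inv_mul_eq_div] using hfin
  simpa [hH, hI, hP, hm] using hfin'

/-! ### ★★ The log-Sobolev inequality on polynomials -/

/-- ★★ **The Bakry–Émery logarithmic Sobolev inequality for the Haar probability measure of `SU(N)`** on the algebra of
polynomial (`SU(N)`-finite) functions: for `N ≥ 1` and every `u ∈ 𝒫_n`,
`Ent_σ(u²) = ∫ u² log u² dσ − (∫ u² dσ) log(∫ u² dσ) ≤ (4/N) ∫ Γ(u,u) dσ`,
i.e. `LS(2/N)` for the Markov triple `(SU(N), σ, Γ)` with `Γ(u,u) = ∑_α (D_α u)² = |∇u|²` (Hilbert–Schmidt bi-invariant metric,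
`Ric = N/2`, curvature condition `CD(N/2, ∞)`): Bakry–Gentil–Ledoux Prop. 5.7.1 `Ent_μ(f²) ≤ (2/ρ) ℰ(f)` with `ρ = N/2`;
equivalently Shen–Zhu–Zhu's log-Sobolev inequality (4.12) `μ(F² log F²) ≤ (2/K_S) μ(|∇F|²)` in the free case `β = 0`,
one link, `K_S = N/2`.  From `logSobolev_poly_pos` applied to `u² + ε` (`Γ(u²+ε)/(u²+ε) = 4u²Γ(u,u)/(u²+ε) ≤ 4Γ(u,u)`)
and `ε ↓ 0` by continuity of the entropy in `ε`.
[cite: BakryGentilLedoux2014, Prop. 5.7.1] [cite: ShenZhuZhuCMP2023, Theorem 4.2 (4.12), β = 0] -/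
theorem logSobolev_poly (hN : N ≠ 0) {n : ℕ} {u : Matrix (Fin N) (Fin N) ℂ → ℝ} (hu : u ∈ polySpace N n) :
    ∫ g : SUN N, u g ^ 2 * Real.log (u g ^ 2) ∂(haarSU N) -
        (∫ g : SUN N, u g ^ 2 ∂(haarSU N)) * Real.log (∫ g : SUN N, u g ^ 2 ∂(haarSU N)) ≤
      4 / (N : ℝ) * ∫ g : SUN N, Gam u u g ∂(haarSU N) := by
  set σ := haarSU N with hσ
  have hus : ContDiff ℝ ∞ u := contDiff_of_mem_polySpace hu
  have huc : Continuous fun g : SUN N => u g := continuous_restrict hus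
  have hNpos : (0 : ℝ) < N := Nat.cast_pos.2 (Nat.pos_of_ne_zero hN)
  have hmem : ∀ ε : ℝ, (fun Q => u Q ^ 2 + ε) ∈ polySpace N (n + n) := by
    intro ε
    have e : (fun Q => u Q ^ 2 + ε) = u * u + fun _ => ε := by
      funext Q; simp [sq]
    rw [e]
    exact Submodule.add_mem _ (mul_mem_polySpace hu hu) (const_mem_polySpace _ ε)
  -- the inequality for `u² + ε`, `ε > 0`
  have hε : ∀ ε : ℝ, 0 < ε →
      ∫ g : SUN N, (u g ^ 2 + ε) * Real.log (u g ^ 2 + ε) ∂σ -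
          (∫ g : SUN N, (u g ^ 2 + ε) ∂σ) * Real.log (∫ g : SUN N, (u g ^ 2 + ε) ∂σ) ≤
        4 / (N : ℝ) * ∫ g : SUN N, Gam u u g ∂σ := by
    intro ε hε
    have h := logSobolev_poly_pos hN (hmem ε) hε (fun g => by nlinarith [sq_nonneg (u g)])
    refine h.trans ?_
    have hpt : ∀ g : SUN N, Gam (fun Q => u Q ^ 2 + ε) (fun Q => u Q ^ 2 + ε) g / (u g ^ 2 + ε) ≤ 4 * Gam u u g := by
      intro g
      have hΓ := Gam_self_nonneg u (g : Matrix (Fin N) (Fin N) ℂ)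
      have hsq := sq_nonneg (u g)
      rw [Gam_sq_add_const hus, div_le_iff₀ (by positivity)]
      nlinarith
    have i1 : Integrable (fun g : SUN N => Gam (fun Q => u Q ^ 2 + ε) (fun Q => u Q ^ 2 + ε) g / (u g ^ 2 + ε)) σ :=
      integrable_of_continuous_SUN ((continuous_restrict (contDiff_Gam (contDiff_of_mem_polySpace (hmem ε))
        (contDiff_of_mem_polySpace (hmem ε)))).div ((huc.pow 2).add continuous_const)
        fun g => ne_of_gt (show (0 : ℝ) < u g ^ 2 + ε by positivity)) _
    have i2 : Integrable (fun g : SUN N => 4 * Gam u u g) σ :=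
      (integrable_of_continuous_SUN (continuous_restrict (contDiff_Gam hus hus)) _).const_mul 4
    have hint := integral_mono i1 i2 hpt
    rw [integral_const_mul] at hint
    calc 1 / (N : ℝ) * ∫ g : SUN N, Gam (fun Q => u Q ^ 2 + ε) (fun Q => u Q ^ 2 + ε) g / (u g ^ 2 + ε) ∂σ
        ≤ 1 / (N : ℝ) * (4 * ∫ g : SUN N, Gam u u g ∂σ) := mul_le_mul_of_nonneg_left hint (by positivity)
      _ = 4 / (N : ℝ) * ∫ g : SUN N, Gam u u g ∂σ := by ring
  -- `ε ↓ 0`: the left-hand side is continuous in `ε`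
  set F : ℝ → ℝ := fun ε => ∫ g : SUN N, (u g ^ 2 + ε) * Real.log (u g ^ 2 + ε) ∂σ -
    (∫ g : SUN N, (u g ^ 2 + ε) ∂σ) * Real.log (∫ g : SUN N, (u g ^ 2 + ε) ∂σ) with hF
  have hF1 : Continuous fun ε : ℝ => ∫ g : SUN N, (u g ^ 2 + ε) * Real.log (u g ^ 2 + ε) ∂σ := by
    have h := continuous_parametric_integral_of_continuous (μ := σ)
      (f := fun (ε : ℝ) (g : SUN N) => (u g ^ 2 + ε) * Real.log (u g ^ 2 + ε)) ?_ isCompact_univ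
    · simpa [Measure.restrict_univ] using h
    · exact Real.continuous_mul_log.comp (((huc.pow 2).comp continuous_snd).add continuous_fst)
  have hF2 : Continuous fun ε : ℝ => ∫ g : SUN N, (u g ^ 2 + ε) ∂σ := by
    have h := continuous_parametric_integral_of_continuous (μ := σ)
      (f := fun (ε : ℝ) (g : SUN N) => u g ^ 2 + ε) ?_ isCompact_univ
    · simpa [Measure.restrict_univ] using h
    · exact ((huc.pow 2).comp continuous_snd).add continuous_fst
  have hFc : Continuous F := hF1.sub (Real.continuous_mul_log.comp hF2)
  have htend : Tendsto F (𝓝[>] 0) (𝓝 (F 0)) := (hFc.tendsto 0).mono_left nhdsWithin_le_nhds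
  have hev : ∀ᶠ ε in 𝓝[>] (0 : ℝ), F ε ≤ 4 / (N : ℝ) * ∫ g : SUN N, Gam u u g ∂σ := by
    filter_upwards [self_mem_nhdsWithin] with ε hε' using hε ε hε'
  have hfin : F 0 ≤ 4 / (N : ℝ) * ∫ g : SUN N, Gam u u g ∂σ := le_of_tendsto htend hev
  simpa [hF] using hfin

end SUNBakryEmery

end Literature.MathematicalPhysics.QuantumFieldTheory
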